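import Summits.Ventures.CertifiedArithmetic.LowPrec.GemmEnvelopePinned
import Summits.Ventures.CertifiedArithmetic.LowPrec.GemmEnvelopeRowP5

/-!
# GEMM-level envelopes, part (t): the per-vector sliver at the GEMM output (pub-lowprec gemm gen 22, LXX-t)

HONEST FRAMING: certified error envelopes and provably optimal rounding/accumulation schemes for
low-precision formats under stated cost models; every table by two implementations; no hardware or
vendor claims.

Row P5x (part (j), `vecE4M3_fails_above`): beyond `2θ = 516096/17` the per-vector E4M3 datapath exceeds the
envelope value `35/289` on `C(κ)` (quantiser level, margin `↓ 0` at `2θ`).  Here the output-level face: for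
`κ ≥ 30720` (vectors of length `≥ 3`) the AMAX-EXACT per-vector input `(448, 0, v, …)·(0, 448, v, …)`,
`v = 15/1024 + 2⁻²⁰ ↦ 1/64` (numerator `448`, scale `1`), has full-pipeline error
`> C_Π·L`, `C_Π = 35/289 + (1/2048)(324/289) + (1/257)(324/289)(1 + 1/2048)`, for EVERY realisation of the
accumulation model (`γ ≤ 1/2048`: Binary32, `K ≤ 8193` / two-level `k + B ≤ 8193`) and output model
(`δ ≤ 1/257`: BFloat16 or finer) — the same cell and the same inequality as the MX witness of part (o) at
`κ ≥ 16384`, a factor two later in `κ` (the factor-two law of parts (k), (m)).  So beyond `κ ≥ 30720` neither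
datapath meets the pipeline tie constant of rows P2–P7 at the GEMM output, realisation-free; proved with the
pinning lemmas of part (q) and `pipeline_witness_up` of part (p). [cite: RouhaniEtAl2023MX, §5.1, §6.1];
[cite: MicikeviciusEtAl2022, §3]
-/

namespace Summit.Ventures.CertifiedArithmetic.LowPrec.GemmEnvelope

open Finset
open Literature.ComputerArithmetic.FloatingPoint
open Literature.ComputerArithmetic.FloatingPoint.Format
open Literature.ComputerArithmetic.FloatingPoint.MiniFloat
open Literature.ComputerArithmetic.FloatingPoint.MXBlock
open Summit.Ventures.CertifiedArithmetic.LowPrec.SR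

/-- **ROW P5x at the GEMM output** (`κ ≥ 30720`, vectors of length `≥ 3`): an amax-exact per-vector E4M3 input in
`C(κ)` whose full-pipeline error exceeds `C_Π·L` for every realisation of accumulation `γ ≤ 1/2048` and output
`δ ≤ 1/257` (witness `(448, 0, v, …)·(0, 448, v, …)`, `v = 15361/2²⁰ ↦ 1/64`;
`(C_Π + 1)·v² < (2047/2048)(256/257)/4096`). [cite: RouhaniEtAl2023MX, §5.1, §6.1] -/
theorem row_P5x_vec_fails_pipelines {B k : ℕ} (hB : 0 < B) (hk : 3 ≤ k) {κ : ℚ} (hκ : 30720 ≤ κ) :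
    ∃ (a b : Fin B → Fin k → ℚ) (Aa Ab : ℚ),
      (∀ j i, |a j i| ≤ Aa ∧ (a j i = 0 ∨ Aa ≤ κ * |a j i|)) ∧ (∀ j, ∃ i, |a j i| = Aa) ∧
      (∀ j i, |b j i| ≤ Ab ∧ (b j i = 0 ∨ Ab ≤ κ * |b j i|)) ∧ (∀ j, ∃ i, |b j i| = Ab) ∧
      ∀ (γ δ acc c : ℚ), γ ≤ 1 / 2048 → δ ≤ 1 / 257 →
        |acc - ∑ j, ∑ i, (Aa / E4M3.maxRat * (roundNE E4M3 (a j i / (Aa / E4M3.maxRat))).toRat) *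
            (Ab / E4M3.maxRat * (roundNE E4M3 (b j i / (Ab / E4M3.maxRat))).toRat)|
          ≤ γ * ∑ j, ∑ i, |(Aa / E4M3.maxRat * (roundNE E4M3 (a j i / (Aa / E4M3.maxRat))).toRat) *
            (Ab / E4M3.maxRat * (roundNE E4M3 (b j i / (Ab / E4M3.maxRat))).toRat)| →
        |c - acc| ≤ δ * |acc| →
        (35 / 289 + 1 / 2048 * (324 / 289) + 1 / 257 * (324 / 289) * (1 + 1 / 2048))
            * ∑ j, ∑ i, |a j i * b j i| < |c - ∑ j, ∑ i, a j i * b j i| := by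
  obtain ⟨n, rfl⟩ : ∃ n, k = n + 3 := ⟨k - 3, by omega⟩
  have hM : E4M3.maxRat = 448 := by decide +kernel
  set v : ℚ := 15361 / 1048576 with hvdef
  have hv0 : (0 : ℚ) < v := by rw [hvdef]; norm_num
  have hv15 : 15 / 1024 < v := by rw [hvdef]; norm_num
  have hv16 : v ≤ 1 / 64 := by rw [hvdef]; norm_num
  have hv448 : v ≤ 448 := by rw [hvdef]; norm_num
  have hκv : (448 : ℚ) ≤ κ * v := by rw [hvdef]; nlinarith
  set a' : Fin (n + 3) → ℚ := Fin.cases (448 : ℚ) (Fin.cases (0 : ℚ) (fun _ : Fin (n + 1) => v)) with ha'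
  set b' : Fin (n + 3) → ℚ := Fin.cases (0 : ℚ) (Fin.cases (448 : ℚ) (fun _ : Fin (n + 1) => v)) with hb'
  obtain ⟨hca, hcb, ha0, hb1⟩ := pinned_class (n := n) hv0 hv448 hκv ha' hb'
  have hQ0 : (448 : ℚ) / E4M3.maxRat * (roundNE E4M3 (0 / (448 / E4M3.maxRat))).toRat = 0 := by
    rw [zero_div, toRat_roundNE_zero, mul_zero]
  obtain ⟨hS1, hS1a, hS2, hS3⟩ := pinned_sums (n := n) (A := 448) (x := v)
    (fun y : ℚ => (448 : ℚ) / E4M3.maxRat * (roundNE E4M3 (y / (448 / E4M3.maxRat))).toRat) hQ0 ha' hb'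
  have hq : (448 : ℚ) / E4M3.maxRat * (roundNE E4M3 (v / (448 / E4M3.maxRat))).toRat = 1 / 64 := by
    rw [hM, div_self (by norm_num : (448 : ℚ) ≠ 0), div_one, one_mul]
    exact toRat_roundNE_E4M3_eq_inv64 hv15 hv16
  rw [hq] at hS1 hS1a
  refine ⟨fun _ => a', fun _ => b', 448, 448, fun _ i => hca i, fun _ => ⟨0, ha0⟩, fun _ i => hcb i,
    fun _ => ⟨Fin.succ 0, hb1⟩, fun γ δ acc c hγ hδ hacc hc => ?_⟩
  simp only [hS1, hS1a, hS2, hS3, sum_const, card_univ, Fintype.card_fin, nsmul_eq_mul] at hacc ⊢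
  have hN : (0 : ℚ) < (B : ℚ) * ((n + 1 : ℕ) : ℚ) := by
    have : (0 : ℚ) < (B : ℚ) := by exact_mod_cast hB
    positivity
  have e1 : ((B : ℚ) * (((n + 1 : ℕ) : ℚ) * (1 / 64 * (1 / 64))) : ℚ)
      = (B : ℚ) * ((n + 1 : ℕ) : ℚ) * (1 / 64 * (1 / 64)) := by ring
  have e2 : ((B : ℚ) * (((n + 1 : ℕ) : ℚ) * |(1 : ℚ) / 64 * (1 / 64)|) : ℚ)
      = (B : ℚ) * ((n + 1 : ℕ) : ℚ) * |(1 : ℚ) / 64 * (1 / 64)| := by ring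
  have e3 : ((B : ℚ) * (((n + 1 : ℕ) : ℚ) * (v * v)) : ℚ) = (B : ℚ) * ((n + 1 : ℕ) : ℚ) * (v * v) := by ring
  have e4 : ((B : ℚ) * (((n + 1 : ℕ) : ℚ) * |v * v|) : ℚ) = (B : ℚ) * ((n + 1 : ℕ) : ℚ) * |v * v| := by ring
  rw [e1, e2] at hacc
  rw [e3, e4]
  exact pipeline_witness_up hN (by norm_num) (mul_pos hv0 hv0) hγ hδ hacc hc (by rw [hvdef]; norm_num)

end Summit.Ventures.CertifiedArithmetic.LowPrec.GemmEnvelope
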